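import Summits.AtomisticToContinuum.Crystallization.Theorems.PRVarianceCertificateCoerciveVarianceCertificateOptimalHcp

/-!
# Stub `stub_template` of line `merge-perron`, crux `PerronTransitivity.NoFractionalGain`
(stmt-AtomisticToContinuum-15098, route `PerronTransitivity`)

THE e_LJ-OPTIMAL hcp TEMPLATE EXISTS: some `a, h > 0` minimise the Lennard-Jones energy per particle of
`hcpPeriodicConfiguration` over all `a', h' > 0`.  This is the restriction to positive parameters of the
LANDED theorem `PRVarianceCertificate.CoerciveVarianceCertificate.stub_optimalHcp` (which quantifies over
all `a', h' ≠ 0`); nothing else is used.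
-/

noncomputable section

namespace Summit.AtomisticToContinuum.Crystallization.Theorems.PerronTransitivity.NoFractionalGain

open Literature.MathematicalPhysics.StatisticalMechanics

/-- **Stub `stub_template` (line `merge-perron`, crux `NoFractionalGain`, stmt-AtomisticToContinuum-15098).**
Some hcp scale `(a, h)` with `a, h > 0` minimises the Lennard-Jones energy per particle over the whole
two-parameter hcp family `a', h' > 0`.  Corollary of the landed
`PRVarianceCertificate.CoerciveVarianceCertificate.stub_optimalHcp` (minimality over all `a', h' ≠ 0`),
restricted to `0 < a'`, `0 < h'`. [folklore] -/
theorem stub_template : ∃ (a h : ℝ) (ha : 0 < a) (hh : 0 < h),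
    ∀ (a' h' : ℝ) (ha' : 0 < a') (hh' : 0 < h'),
      (hcpPeriodicConfiguration ha.ne' hh.ne').energyPerParticle lennardJones ≤
        (hcpPeriodicConfiguration ha'.ne' hh'.ne').energyPerParticle lennardJones := by
  obtain ⟨a, h, ha, hh, hmin⟩ :=
    Summit.AtomisticToContinuum.Crystallization.Theorems.PRVarianceCertificate.CoerciveVarianceCertificate.stub_optimalHcp
  exact ⟨a, h, ha, hh, fun a' h' ha' hh' => hmin a' h' ha'.ne' hh'.ne'⟩

end Summit.AtomisticToContinuum.Crystallization.Theorems.PerronTransitivity.NoFractionalGain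

end
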